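import Summits.BirchSwinnertonDyer.BirchSwinnertonDyer.Theorems.CMKolyvaginAtInertTwoPairMemberOneKolAtTwo
import Summits.BirchSwinnertonDyer.BirchSwinnertonDyer.Theorems.CMKolyvaginAtInertTwoPairMemberTwoKolAtTwo
import Summits.BirchSwinnertonDyer.BirchSwinnertonDyer.Theorems.CMKolyvaginAtInertTwoPairMemberHlocKolAtTwo
import Summits.BirchSwinnertonDyer.BirchSwinnertonDyer.Theorems.GenusKolyvaginAtTwoVisiblePairAtTwoCasselsTateShaThree
import Literature.NumberTheory.GaloisCohomology.PoitouTateNumberField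
import HarnessLib

/-!
# Route `CMKolyvaginAtInertTwo`, crux `CMKolyvaginExactAtInertTwo` (stmt-BirchSwinnertonDyer-24277):
# T2 input (iii) ASSEMBLED for an ARBITRARY SUPPORT PREDICATE and with the KILL CLAUSE — the two
# Cassels–Tate member formulas over `ℚ` at `2` for the canonical pairing data, in the shape the
# kill-clause telescope consumes

Seat `bsd-line-cmk2-p1` g17 (cell `bsd-print-cf2`); helper (`--supports stmt-BirchSwinnertonDyer-24277`).
THEOREMS ONLY: no definition, no named fact, no `sorry`; no item is closed; BSD is not proved by this.

T2 KIT INTERFACE REPAIR, member side, composed (KERNEL-STATUS-p2-port.md §17): seat g16's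
`hV₁/hV₂_canonical_of_kill` (p708946) with (a) the support predicate `kolPrime W K (L+L)` (depth `2L`)
replaced by any `Kol` implying it — so that the classes `c₁`, `c₂` need only be given, with Lemma 4.3 over
`ℚ` and Prop. 4.4 across, on levels supported on the telescope's depth-`(2L+1)` Kolyvagin primes (the
level-change road to the Selmer condition at the ramified `q ∣ d_K`) — and (b) the test-class clause
`2^{2M₀} • t = 0`, `2M₀ ≤ L` replaced by `2^L • t = 0`, `M₀ ≤ L` — which the kill-clause telescope
(`card_mul_card_le_two_pow_two_mul_of_injective_of_kill` + `hCTV_of_members_of_kill`, this seat) supplies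
from `2^k • t = 0` once `L ≥ k`. Composition of `hV₁/hV₂_of_localTerm_of_kol` with
`hloc₁/hloc₂_canonical_of_rel_of_kol`, Tate's reciprocity (`sumInvLocalizationEqZero_canonical_of_numberField`)
and `Ш³(ℚ, μ) = 0` (`VisiblePairAtTwo.shaThree_mu_eq_zero`) supplied; the binders `hkill` (finiteness of the
two `Ш[2^∞]`, `L ≥ v₂ #Ш`: `zsmul_pow_eq_zero_of_finite_of_padicValNat_le`) and `ι₁`, `ι₂`
(`exists_selmerToSha_of_finite`) keep their g16 sources.

* `hV₁_canonical_of_kol`, `hV₂_canonical_of_kol`.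

References: [McCallumLMS1991] §4 Prop. 4.4, 4.7, §5 Lemma 5.3, Thm. 5.4; [MilneADT2006] I Thm. 4.10, §6 Prop. 6.9.
-/

set_option linter.dupNamespace false -- tree convention: `Summit.BirchSwinnertonDyer.BirchSwinnertonDyer.Theorems` (summit = sub-problem)
set_option autoImplicit false

noncomputable section

open scoped Classical
open scoped AddSubgroup

universe u

namespace Summit.BirchSwinnertonDyer.BirchSwinnertonDyer.Theorems.KolyvaginPairDataTwo

open WeierstrassCurve NumberField IsDedekindDomain Field Function Rat.HeightOneSpectrum
open Literature.NumberTheory.EllipticCurves Literature.NumberTheory.GaloisRepresentations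
open Literature.NumberTheory.GaloisCohomology
open Literature.NumberTheory.GaloisRepresentations.DiscreteGaloisModule (mu)
open Literature.NumberTheory.EllipticCurves.KolyvaginDescent
open Literature.GroupTheory.FiniteAbelian
open Summit.BirchSwinnertonDyer.BirchSwinnertonDyer.Theorems.GenusExact.VisiblePairAtTwo

section Canonical

variable {W : WeierstrassCurve ℚ} [W.IsElliptic] [W.IsGloballyMinimal] {K : Type} [Field K] [NumberField K]
  {L : ℕ} [(twin W K).IsElliptic] [NeZero (2 ^ L * 2 ^ L)]

/-- **The member formula `hV₁` for THE Cassels–Tate pairing of `E` at level `2^L`, record-free, for an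
arbitrary support predicate `Kol ≤ kolPrime W K (2L)` and with the kill clause `2^L • t = 0`** (McCallum
Prop. 4.7 + Lemma 5.3 over `ℚ` at `2`): `hV₁_of_localTerm_of_kol` ∘ `hloc₁_canonical_of_rel_of_kol` with Tate's
reciprocity and `Ш³(ℚ, μ) = 0` supplied. [cite: McCallumLMS1991, §4 Prop. 4.7, §5 Lemma 5.3, Thm. 5.4 (proof)]
[cite: MilneADT2006, Ch. I Thm. 4.10 and §6 Prop. 6.9] -/
theorem hV₁_canonical_of_kol {M₀ : ℕ} (c₁ : ℕ → galH1Torsion W (lvl (L + L)))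
    (c₂ : ℕ → galH1Torsion (twin W K) (lvl (L + L))) (hΔ : W.Δ < 0)
    (hρ2 : W.HasSurjectiveModNGaloisRep 2) (hL : M₀ ≤ L) (hL1 : 1 ≤ L)
    (Kol : ℕ → Prop) (hKol : ∀ ℓ, Kol ℓ → kolPrime W K (L + L) ℓ)
    (hkill : ∀ a ∈ W.sha, ((2 : ℤ) ^ (2 * L)) • a = 0 → ((2 : ℤ) ^ L) • a = 0)
    (loc_c₁_fin : ∀ m, KolSupp Kol m → Even m.primeFactors.card →
      ∀ v : HeightOneSpectrum (𝓞 ℚ), (m : 𝓞 ℚ) ∉ v.asIdeal → c₁ m ∈ selmerLocalKer W (v.adicCompletion ℚ) (lvl (L + L)))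
    (loc_c₁_inf : ∀ m, KolSupp Kol m → Even m.primeFactors.card →
      ∀ w : InfinitePlace ℚ, c₁ m ∈ selmerLocalKer W w.Completion (lvl (L + L)))
    (h44₂₁ : ∀ ℓ m : ℕ, Kol ℓ → KolSupp Kol (ℓ * m) →
      Odd m.primeFactors.card → ∀ a : ℕ,
        ((2 : ℤ) ^ a) • c₁ (ℓ * m) ∈ loc₁ W (L + L) (pl ℓ) ↔ ((2 : ℤ) ^ a) • c₂ m ∈ a₂ W K (L + L) ℓ)
    (e : geomTorsion W ((2 ^ L * 2 ^ L : ℕ) : ℤ) → geomTorsion W ((2 ^ L * 2 ^ L : ℕ) : ℤ) → AlgebraicClosure ℚ)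
    (hμ : ∀ S T, e S T ^ (2 ^ L * 2 ^ L) = 1)
    (hadd₁ : ∀ S₁ S₂ T, e (S₁ + S₂) T = e S₁ T * e S₂ T)
    (hadd₂ : ∀ S T₁ T₂, e S (T₁ + T₂) = e S T₁ * e S T₂)
    (hgal : ∀ (σ : absoluteGaloisGroup ℚ) (S T : geomTorsion W ((2 ^ L * 2 ^ L : ℕ) : ℤ)),
      σ • e S T = e (σ • S) (σ • T))
    (halt : ∀ T, e T T = 1) (hnondeg : ∀ T, (∀ S, e S T = 1) → T = 0)
    (ι₁ : selmerGroup W (lvl (L + L)) →+ (W.sha)[(2 ^ L : ℕ)])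
    (hι₁ : ∀ z, shaTorsionVal W (2 ^ L) (ι₁ z) = torsionH1ToH1 W (lvl (L + L)) z) :
    ∀ ℓ m' : ℕ, Kol ℓ → KolSupp Kol (ℓ * m') → ¬ ℓ ∣ m' →
      Odd m'.primeFactors.card →
      ∀ (j N a b : ℕ) (t : galH1Torsion W (lvl (L + L))) (ht : t ∈ selmerGroup W (lvl (L + L)))
        (hz : ((2 : ℤ) ^ j) • c₁ (ℓ * m') ∈ selmerGroup W (lvl (L + L))),
      ((2 : ℤ) ^ N) • t = 0 → ((2 : ℤ) ^ L) • t = 0 →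
      (∀ q ∈ m'.primeFactors, t ∈ a₁ W (L + L) q) → L + L - M₀ ≤ j →
      N + M₀ ≤ L + L → N ≤ j → a + b + 1 = N →
      ((2 : ℤ) ^ (a + (j - N))) • c₂ m' ∉ a₂ W K (L + L) ℓ →
      ((2 : ℤ) ^ b) • t ∉ a₁ W (L + L) ℓ →
      ((ctLevelPairing W (2 ^ L) e hμ hadd₁ hadd₂ hgal (LocalInvariants.canonical ℚ (2 ^ L * 2 ^ L)) halt
        (sumInvLocalizationEqZero_canonical_of_numberField ℚ (2 ^ L * 2 ^ L)) (shaThree_mu_eq_zero ℚ (2 ^ L * 2 ^ L))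
        (localTerm_finite_support (W := W) (m := 2 ^ L) (e := e) (hμ := hμ) (hadd₁ := hadd₁) (hadd₂ := hadd₂)
          (hgal := hgal) halt (LocalInvariants.canonical ℚ (2 ^ L * 2 ^ L)))).comp ι₁).compl₂ ι₁ ⟨_, hz⟩ ⟨t, ht⟩ ≠ 0 := by
  exact hV₁_of_localTerm_of_kol c₁ c₂ hΔ hρ2 hL Kol hKol hkill loc_c₁_fin loc_c₁_inf e hμ hadd₁ hadd₂
    hgal halt
    (LocalInvariants.canonical ℚ (2 ^ L * 2 ^ L))
    (sumInvLocalizationEqZero_canonical_of_numberField ℚ (2 ^ L * 2 ^ L))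
    (shaThree_mu_eq_zero ℚ (2 ^ L * 2 ^ L)) ι₁ hι₁
    (hloc₁_canonical_of_rel_of_kol c₁ c₂ hΔ hL hL1 Kol hKol h44₂₁ e hμ hadd₁ hadd₂ hgal halt hnondeg)

/-- **The member formula `hV₂` for THE Cassels–Tate pairing of `E^{(d_K)}` at level `2^L`, record-free, for an
arbitrary support predicate `Kol` and with the kill clause `2^L • t = 0`**:
`hV₂_of_localTerm_of_kol` ∘ `hloc₂_canonical_of_rel_of_kol` with Tate's reciprocity and `Ш³(ℚ, μ) = 0` supplied.
[cite: McCallumLMS1991, §4 Prop. 4.7, §5 Lemma 5.3, Thm. 5.4 (proof)] [cite: MilneADT2006, Ch. I Thm. 4.10 and §6 Prop. 6.9] -/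
theorem hV₂_canonical_of_kol {M₀ : ℕ} (c₁ : ℕ → galH1Torsion W (lvl (L + L)))
    (c₂ : ℕ → galH1Torsion (twin W K) (lvl (L + L))) (hK : IsImaginaryQuadratic K)
    (hoddK : Odd (NumberField.discr K)) (hΔ : W.Δ < 0)
    (hρ2 : W.HasSurjectiveModNGaloisRep 2) (hL : M₀ ≤ L) (hL1 : 1 ≤ L)
    (Kol : ℕ → Prop) (hKol : ∀ ℓ, Kol ℓ → kolPrime W K (L + L) ℓ)
    (hkill : ∀ a ∈ (twin W K).sha, ((2 : ℤ) ^ (2 * L)) • a = 0 → ((2 : ℤ) ^ L) • a = 0)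
    (loc_c₂_fin : ∀ m, KolSupp Kol m → Odd m.primeFactors.card →
      ∀ v : HeightOneSpectrum (𝓞 ℚ), (m : 𝓞 ℚ) ∉ v.asIdeal →
        c₂ m ∈ selmerLocalKer (twin W K) (v.adicCompletion ℚ) (lvl (L + L)))
    (loc_c₂_inf : ∀ m, KolSupp Kol m → Odd m.primeFactors.card →
      ∀ w : InfinitePlace ℚ, c₂ m ∈ selmerLocalKer (twin W K) w.Completion (lvl (L + L)))
    (h44₁₂ : ∀ ℓ m : ℕ, Kol ℓ → KolSupp Kol (ℓ * m) →
      Even m.primeFactors.card → ∀ a : ℕ,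
        ((2 : ℤ) ^ a) • c₂ (ℓ * m) ∈ loc₂ W K (L + L) (pl ℓ) ↔ ((2 : ℤ) ^ a) • c₁ m ∈ a₁ W (L + L) ℓ)
    (e : geomTorsion (twin W K) ((2 ^ L * 2 ^ L : ℕ) : ℤ) → geomTorsion (twin W K) ((2 ^ L * 2 ^ L : ℕ) : ℤ) →
      AlgebraicClosure ℚ)
    (hμ : ∀ S T, e S T ^ (2 ^ L * 2 ^ L) = 1)
    (hadd₁ : ∀ S₁ S₂ T, e (S₁ + S₂) T = e S₁ T * e S₂ T)
    (hadd₂ : ∀ S T₁ T₂, e S (T₁ + T₂) = e S T₁ * e S T₂)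
    (hgal : ∀ (σ : absoluteGaloisGroup ℚ) (S T : geomTorsion (twin W K) ((2 ^ L * 2 ^ L : ℕ) : ℤ)),
      σ • e S T = e (σ • S) (σ • T))
    (halt : ∀ T, e T T = 1) (hnondeg : ∀ T, (∀ S, e S T = 1) → T = 0)
    (ι₂ : selmerGroup (twin W K) (lvl (L + L)) →+ ((twin W K).sha)[(2 ^ L : ℕ)])
    (hι₂ : ∀ z, shaTorsionVal (twin W K) (2 ^ L) (ι₂ z) = torsionH1ToH1 (twin W K) (lvl (L + L)) z) :
    ∀ ℓ m' : ℕ, Kol ℓ → KolSupp Kol (ℓ * m') → ¬ ℓ ∣ m' →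
      Even m'.primeFactors.card →
      ∀ (j N a b : ℕ) (t : galH1Torsion (twin W K) (lvl (L + L))) (ht : t ∈ selmerGroup (twin W K) (lvl (L + L)))
        (hz : ((2 : ℤ) ^ j) • c₂ (ℓ * m') ∈ selmerGroup (twin W K) (lvl (L + L))),
      ((2 : ℤ) ^ N) • t = 0 → ((2 : ℤ) ^ L) • t = 0 →
      (∀ q ∈ m'.primeFactors, t ∈ a₂ W K (L + L) q) → L + L - M₀ ≤ j →
      N + M₀ ≤ L + L → N ≤ j → a + b + 1 = N →
      ((2 : ℤ) ^ (a + (j - N))) • c₁ m' ∉ a₁ W (L + L) ℓ →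
      ((2 : ℤ) ^ b) • t ∉ a₂ W K (L + L) ℓ →
      ((ctLevelPairing (twin W K) (2 ^ L) e hμ hadd₁ hadd₂ hgal (LocalInvariants.canonical ℚ (2 ^ L * 2 ^ L)) halt
        (sumInvLocalizationEqZero_canonical_of_numberField ℚ (2 ^ L * 2 ^ L)) (shaThree_mu_eq_zero ℚ (2 ^ L * 2 ^ L))
        (localTerm_finite_support (W := twin W K) (m := 2 ^ L) (e := e) (hμ := hμ) (hadd₁ := hadd₁)
          (hadd₂ := hadd₂) (hgal := hgal) halt (LocalInvariants.canonical ℚ (2 ^ L * 2 ^ L)))).comp ι₂).compl₂ ι₂ ⟨_, hz⟩ ⟨t, ht⟩ ≠ 0 := by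
  exact hV₂_of_localTerm_of_kol c₁ c₂ hK hoddK hΔ hρ2 hL Kol hKol hkill loc_c₂_fin loc_c₂_inf e hμ
    hadd₁ hadd₂ hgal halt
    (LocalInvariants.canonical ℚ (2 ^ L * 2 ^ L))
    (sumInvLocalizationEqZero_canonical_of_numberField ℚ (2 ^ L * 2 ^ L))
    (shaThree_mu_eq_zero ℚ (2 ^ L * 2 ^ L)) ι₂ hι₂
    (hloc₂_canonical_of_rel_of_kol c₁ c₂ hK hoddK hΔ hL hL1 Kol hKol h44₁₂ e hμ hadd₁ hadd₂ hgal halt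
      hnondeg)

end Canonical

end Summit.BirchSwinnertonDyer.BirchSwinnertonDyer.Theorems.KolyvaginPairDataTwo

end
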